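import Summits.HodgeConjecture.HodgeConjecture.Theorems.SixfoldHodgeTypes
import HarnessLib

/-!
# TABLE X (dimension 6) — STATUS v1 of the 31 Hodge-type rows after the cell's jobs (J1–J8, L1–L3, each ×2)

Cell `pub-hodgeav-hg6` (LADDER-HodgeAV row 2, director-hodge req-37 (A) Q2b), lead g0, 2026-08-28. HONEST FRAMING: HC,
`HC_AV`, `HC_CM`, H2 are NOT proved; `HC_CM` is HELD and is only a displayed binder — after the cover v3
(`TableX.hcAtDim_six_of_tableX_cmSplit`, `Theorems/SixfoldTableXCover.lean`) NARROWED to the non-simple CM sixfolds.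
Markman 2025 Thm. 1.5.1 is UNREFEREED (Koike 2004 / Schoen 1998 are its refereed instances for `k = ℚ(i)`, `ℚ(√-3)`).
This module is BOOKKEEPING (decidable data + `decide` audits), no geometry: it re-labels the 31 tokens of
`Theorems/SixfoldHodgeTypes.lean` (v0 verdicts, kept as landed — the tree is append-only) with their v1 STATUS, i.e.
the
v0 verdict refined by the cell's engine jobs, every load-bearing number confirmed by two method-disjoint engines
(dossier `TABLE-X-g6-v1.md`, `jobs/`). What changed: the v0 verdict `weilCarrier` splits into `weilSplit` (rows 11,
17,
19, 20, 22, 27: EVERY member absolutely split — jobs J5 / J5-×2, ring2's typed `isSplitWeilType_*` lemmas) and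
`weilMixed`
(rows 7, 9, 13: an intrinsic member-level invariant decides — jobs J2-bis / J5, each ×2); row 15 (degenerate simple
CM)
becomes `cmSplit` (decided modulo Markman₆ + the displayed CM-splitness hypothesis of COR-CM's
`CorCM.CMSixfoldSplit.hodgeDegenerateCMSixfold_of_markmanSixfolds_of_cmSplit`; generation `B³ = D³ ⊕ W_k` is a kernel
theorem, re-confirmed by job J8); the binder status disappears from the simple rows (`cmMixed` = row 29 = the narrowed
binder). Tokens, `exc₂`, `exc₃` are those of the v0 module (imported, unchanged).

## Status vocabulary (`Status`)
* `print`, `cert`, `weilLower`, `floorProduct`, `cmKernel`, `residueK3P`, `empty` — as the v0 verdicts of the same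
  name
  (`Theorems/SixfoldHodgeTypes.lean`);
* `weilSplit`    — the row carries sixfold Weil classes `W_k` (`k` imaginary quadratic acting with multiplicities
                   `(3,3)`) and EVERY member is ABSOLUTELY SPLIT (some `K`-symmetrised hyperplane class is hyperbolic:
                   a factor of odd `k`-rank rescales the Landherr class to `[-1]` — ring2's typed
                   `isSplitWeilType_prod_of_odd_dim` / `_odd_prod_curve` / `_fourfold_prod_curve_prod_curve`, and the
                   constructive totally positive rescaling on the simple row 11; jobs J5 / J5-×2, 120/120 and 243/243
                   exact instances) ⇒ the whole row lies in the printed range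
                   (`Markman2025_weilClasses_algebraic_hyperbolicSixfold`, UNREFEREED; Schoen `d = 3` / Koike `d = 1`
                   refereed) and the hypothesis of `WeilTypeLadder.NonsplitSixfolds` is never met on it;
* `weilMixed`    — Weil carrier decided PER MEMBER by an intrinsic invariant: row 7 `ℚ(√-Nrd T) ↪ D` (J2-bis), row 9
                   the component class `δ`, row 13 `-N_{F₀/ℚ}(det H_F) ∈ N(kˣ)` (J5): split members ⇒ printed range,
                   NON-split members ⇒ residue R-W6 = `WeilTypeLadder.NonsplitSixfolds` (rung H2; nothing in print);
* `cmSplit`      — simple CM sixfold DEGENERATE (balanced `(3,3)` over exactly one `k ⊂ F`; 21 of 280 type-orbits):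
                   its exceptional classes are EXACTLY the Weil plane `W_k` (`B³ = D³ ⊕ W_k`) and the tree decides the
                   row MODULO Markman's hyperbolic-sixfold statement AND the displayed CM-splitness hypothesis `hS`
                   (COR-CM note CM-WEIL-SPLIT Theorem A: every `k`-balanced CM type carries a split polarization;
                   note-level, not a kernel theorem), consumed by the cover v3 — the row has LEFT the `HC_CM` binder;
                   nothing about `HC_CM` is proved;
* `cmMixed`      — non-simple CM sixfolds (interacting CM products): nondegenerate members kernel-decided, degenerate
                   members under the displayed (narrowed) binder — the ONLY rows it still carries; job J10 tabulates
                   them.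

## What is checked (by `decide`)
`status_card_suffices` / `status_card_printedRange` / `status_card_residual` / `status_card_empty` (15 / 7 / 7 / 2);
`status_exc_eq_zero_of_suffices`; `status_exc_ne_zero_of_residual` (every residual or printed-range row carries an
exceptional class); `status_weil_exc₃` (every Weil-carrier row has `exc₂ = 0 < exc₃`); the residual and printed-range
token lists.

## References
* [MoonenZarhin1999LowDim] B. Moonen, Yu. Zarhin, Math. Ann. 315 (1999), Thm. 0.1, §5; arXiv:math/9901113.
* [Markman2025SecantWeil] E. Markman, arXiv:2502.03415, Thm. 1.5.1 (preprint, unrefereed).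
* [Markman2025SurveySecant] E. Markman, arXiv:2509.23403, Cor. 1.3 (under review).
* [vanGeemen1994HodgeAV] B. van Geemen, LNM 1594 (1994), Lemma 5.2, 5.4, (5.4.1), Thm. 6.12.
* [Schoen1998HodgeWeilAddendum] C. Schoen, Compositio Math. 114 (1998). [Koike2004WeilHodge] K. Koike, Canad. Math.
  Bull. 47 (2004).
* [OMeara1963] O. T. O'Meara, *Introduction to Quadratic Forms* (1963), 71:19.
-/

set_option linter.dupNamespace false

namespace Summit.HodgeConjecture.HodgeConjecture.TableX

/-- Status codes of TABLE X v1 (see the module docstring). [folklore] -/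
inductive Status
  | print | cert | weilLower | floorProduct | cmKernel
  | weilSplit | weilMixed | residueK3P | cmSplit | cmMixed | empty
  deriving DecidableEq, Repr

open Token Status

/-- The status function of TABLE X v1 (2026-08-28, after the cell's jobs J1–J8 and their ×2 partners). [folklore] -/
def status : Token → Status
  | simpleI1 => print | simpleI2 => print | simpleI3 => print | simpleI6 => print
  | simpleII1 => print | simpleII3 => print
  | simpleIII1 => weilMixed
  | simpleIV11 => print
  | weilGeneral33 => weilMixed
  | simpleIV21other => print | simpleIV21Weil => weilSplit
  | simpleIV31generic => cert | simpleIV31Weil => weilMixed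
  | cmSimpleNondeg => cmKernel | cmSimpleDeg33 => cmSplit
  | exS5 => print | exY5k32 => weilSplit | exY5k41 => cert
  | y3xY3k => weilSplit | e2xY4k31 => weilSplit | e3xY3k21 => weilLower | y3xZ3cm => weilSplit
  | sxY4Ecyclic => residueK3P | sxY4ED4aligned => residueK3P | sxY4ED4other => cert
  | ek1ek2xY4Ebiquad => residueK3P | ek2xY4Mbiquad => weilSplit
  | nonInteracting => floorProduct | cmProducts => cmMixed
  | cmRankLeFive => empty | vacuous => empty

/-- "Suffices" verdicts: known methods (print / certificate / lower-dimensional Weil classes / floor / CM kernel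
theorems) decide every member. [folklore] -/
def Status.suffices : Status → Bool
  | print | cert | weilLower | floorProduct | cmKernel => true
  | _ => false

/-- "Printed range" status: every member is decided by the sixfold Weil-class facts in print (Markman 2025,
UNREFEREED for general `k`; Koike / Schoen refereed for `k = ℚ(i)`, `ℚ(√-3)`) — for `cmSplit` additionally modulo the
displayed CM-splitness hypothesis `hS` (note-level). [folklore] -/
def Status.printedRange : Status → Bool
  | weilSplit | cmSplit => true
  | _ => false

/-- "Residual" verdicts: the row carries, for some members, a named residue (R-W6, R-K3P) or the binder `HC_CM`.
[folklore] -/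
def Status.residual : Status → Bool
  | weilMixed | residueK3P | cmMixed => true
  | _ => false

/-- 15 rows are decided by known methods. [folklore] -/
theorem status_card_suffices : (Finset.univ.filter fun t => (status t).suffices).card = 15 := by decide

/-- 7 rows lie entirely in the printed sixfold Weil range (6 split Weil carriers + the degenerate simple CM row).
[folklore] -/
theorem status_card_printedRange : (Finset.univ.filter fun t => (status t).printedRange).card = 7 := by decide

/-- 7 rows carry, for some members, a named residue or the (narrowed) binder. [folklore] -/
theorem status_card_residual : (Finset.univ.filter fun t => (status t).residual).card = 7 := by decide

/-- 2 rows are provably empty in dimension 6. [folklore] -/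
theorem status_card_empty : (Finset.univ.filter fun t => status t = empty).card = 2 := by decide

/-- Every token has one of the four statuses. [folklore] -/
theorem status_suffices_or_printedRange_or_residual_or_empty (t : Token) :
    (status t).suffices = true ∨ (status t).printedRange = true ∨ (status t).residual = true ∨
      status t = empty := by
  revert t; decide

/-- Consistency: a "suffices" row other than the `weilLower` row has no exceptional classes in `B²`, `B³`. [folklore] -/
theorem status_exc_eq_zero_of_suffices (t : Token) (h : (status t).suffices = true) (h' : status t ≠ weilLower) :
    exc₂ t = 0 ∧ exc₃ t = 0 := by
  revert t; decide

/-- Consistency: every residual or printed-range row carries an exceptional class. [folklore] -/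
theorem status_exc_ne_zero_of_residual (t : Token) (h : (status t).residual = true ∨ (status t).printedRange = true) :
    exc₂ t ≠ 0 ∨ exc₃ t ≠ 0 := by
  revert t; decide

/-- Consistency: every Weil-carrier row (split or mixed) has `B² = D²` and a non-zero exceptional part in `B³`.
[folklore] -/
theorem status_weil_exc₃ (t : Token) (h : status t = weilSplit ∨ status t = weilMixed) : exc₂ t = 0 ∧ 0 < exc₃ t := by
  revert t; decide

/-- The residual tokens, listed: the type-III(1), general-`(k,δ)` and sextic-`P33` simple Weil rows, the three
K3-partner rows and the CM-product row (the narrowed binder). [folklore] -/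
theorem status_residual_tokens :
    (Finset.univ.filter fun t => (status t).residual) =
      {simpleIII1, weilGeneral33, simpleIV31Weil, sxY4Ecyclic, sxY4ED4aligned, ek1ek2xY4Ebiquad, cmProducts} := by
  decide

/-- The printed-range Weil rows, listed. [folklore] -/
theorem status_printedRange_tokens :
    (Finset.univ.filter fun t => (status t).printedRange) =
      {simpleIV21Weil, cmSimpleDeg33, exY5k32, y3xY3k, e2xY4k31, y3xZ3cm, ek2xY4Mbiquad} := by
  decide

end Summit.HodgeConjecture.HodgeConjecture.TableX
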